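import Summits.Ventures.HodgeRepro.OrbitCount

/-!
# The orbits of size `|G|/2`: `4·#smallOrbits = ι·2^(m/2)` for every finite `(G, c)` (seat `p1`, gen 5)

Blind re-derivation cell `pub-hodge-repro`.  Continues `OrbitCount.lean`.  Theorem (b) of `proofs/P1.md` §8: the type
squares with a non-trivial stabiliser are the disjoint union, over the `ι` involutions `g ∉ {1, c}`, of the squares fixed
by `g` (a square has at most one non-trivial twist fixing it — `fix_unique`), so there are `ι·(m/2)·2^((m−2)/2)` of
them; they form the orbits of size `|G|/2 = m`, hence `ι·2^(m/2−2)` such orbits (the sealed size lists: `ι` orbits of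
size `4` at order `8` — `0, 2, 2, 6, 4, 0` — and `2ι` orbits of size `6` at order `12` — `0, 4, 12, 0`).

* `symmetricSquares c` — the squares with stabiliser of order `2`; `symmetricSquares_eq_biUnion` — the disjoint union
  of the `fixedSquares c g`, `g ∈ otherInvolutions c`; **`card_symmetricSquares`** — `4·#symmetricSquares = ι·m·2^(m/2)`;
* `smallOrbits c` — the orbits of size `|G|/2`; `card_smallOrbits_mul` — `#smallOrbits·m = #symmetricSquares`
  (each small orbit consists of `m` symmetric squares, and every symmetric square lies in a small orbit);
* **`four_mul_card_smallOrbits`** — `4·#smallOrbits = ι·2^(m/2)`, and `card_eq_of_not_mem_smallOrbits`: every other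
  orbit has size `|G|`.
-/

open Finset

namespace HodgeRepro.TwistOrbit

variable {G : Type*} [Group G] [DecidableEq G] [Fintype G]

/-! ### Symmetric squares -/

/-- The squares with a non-trivial stabiliser (of order exactly `2`). -/
def symmetricSquares (c : G) : Finset (Finset (Finset G)) :=
  (squares c).filter fun S => (stabilizerSet S).card = 2

/-- The stabiliser of a square has order `1` or `2` (given `|G| > 4`). -/
theorem card_stabilizerSet_eq_one_or_two {c : G} (hc : IsComplexConj c) (h4 : 4 < Fintype.card G)
    {S : Finset (Finset G)} (hS : S ∈ squares c) :
    (stabilizerSet S).card = 1 ∨ (stabilizerSet S).card = 2 := by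
  obtain ⟨Φ, p, p', hΦ, hpp', rfl⟩ := mem_squares.1 hS
  have hle := card_stabilizerSet_le_two hc hΦ hpp' (exists_third_place h4 p p')
  have hge : 1 ≤ (stabilizerSet (typeSquare c Φ p p')).card := card_pos.2 ⟨1, one_mem_stabilizerSet _⟩
  omega

/-- A square has stabiliser of order `2` iff some twist `g ≠ 1` fixes it. -/
theorem card_stabilizerSet_eq_two_iff {c : G} (hc : IsComplexConj c) (h4 : 4 < Fintype.card G)
    {S : Finset (Finset G)} (hS : S ∈ squares c) :
    (stabilizerSet S).card = 2 ↔ ∃ g, g ≠ 1 ∧ rmulSet S g = S := by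
  constructor
  · intro h
    by_contra hcon
    have hsub : stabilizerSet S ⊆ {1} := by
      intro g hg
      rw [mem_singleton]
      by_contra h1
      exact hcon ⟨g, h1, mem_stabilizerSet.1 hg⟩
    have := card_le_card hsub
    rw [card_singleton] at this
    omega
  · rintro ⟨g, hg1, hg⟩
    rcases card_stabilizerSet_eq_one_or_two hc h4 hS with h | h
    · exfalso
      have h1 : (1 : G) ∈ stabilizerSet S := one_mem_stabilizerSet S
      have hg' : g ∈ stabilizerSet S := mem_stabilizerSet.2 hg
      have hsub : ({1, g} : Finset G) ⊆ stabilizerSet S := by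
        rw [insert_subset_iff, singleton_subset_iff]; exact ⟨h1, hg'⟩
      have := card_le_card hsub
      rw [card_pair_eq_two_iff.2 hg1.symm] at this
      omega
    · exact h

/-- A twist `g ≠ 1` fixing a square is an involution other than `c`. -/
theorem mem_otherInvolutions_of_fix {c : G} (hc : IsComplexConj c) (h4 : 4 < Fintype.card G)
    {S : Finset (Finset G)} (hS : S ∈ squares c) {g : G} (hg1 : g ≠ 1) (hg : rmulSet S g = S) :
    g ∈ otherInvolutions c := by
  obtain ⟨Φ, p, p', hΦ, hpp', rfl⟩ := mem_squares.1 hS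
  rw [mem_otherInvolutions]
  rcases eq_one_or_involution_of_fix hc hΦ hpp' (exists_third_place h4 p p') hg with e | ⟨h1, h2, -, -⟩
  · exact absurd e hg1
  · exact ⟨h1, hg1, h2⟩

/-- **The symmetric squares are the union of the `fixedSquares c g`, `g` an involution other than `c`.** -/
theorem symmetricSquares_eq_biUnion {c : G} (hc : IsComplexConj c) (h4 : 4 < Fintype.card G) :
    symmetricSquares c = (otherInvolutions c).biUnion (fixedSquares c) := by
  ext S
  simp only [symmetricSquares, mem_filter, mem_biUnion, mem_fixedSquares]
  constructor
  · rintro ⟨hS, h2⟩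
    obtain ⟨g, hg1, hg⟩ := (card_stabilizerSet_eq_two_iff hc h4 hS).1 h2
    exact ⟨g, mem_otherInvolutions_of_fix hc h4 hS hg1 hg, hS, hg⟩
  · rintro ⟨g, hg, hS, hgS⟩
    rw [mem_otherInvolutions] at hg
    exact ⟨hS, (card_stabilizerSet_eq_two_iff hc h4 hS).2 ⟨g, hg.2.1, hgS⟩⟩

/-- The `fixedSquares c g`, `g ∈ otherInvolutions c`, are pairwise disjoint (`fix_unique`). -/
theorem pairwiseDisjoint_fixedSquares {c : G} (hc : IsComplexConj c) (h4 : 4 < Fintype.card G) :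
    ((otherInvolutions c : Set G)).PairwiseDisjoint (fixedSquares c) := by
  intro g hg g' hg' hne
  rw [Function.onFun, disjoint_left]
  intro S hS hS'
  rw [mem_fixedSquares] at hS hS'
  rw [mem_coe, mem_otherInvolutions] at hg hg'
  obtain ⟨Φ, p, p', hΦ, hpp', rfl⟩ := mem_squares.1 hS.1
  exact hne (fix_unique hc hΦ hpp' (exists_third_place h4 p p') hS.2 hS'.2 hg.2.1 hg'.2.1)

/-- **`4·#symmetricSquares = ι·m·2^(m/2)`**, `m = |G|/2 > 2`: the symmetric squares number `ι·(m/2)·2^((m−2)/2)`. -/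
theorem card_symmetricSquares {c : G} (hc : IsComplexConj c) (h4 : 4 < Fintype.card G) :
    4 * (symmetricSquares c).card =
      (otherInvolutions c).card * ((Fintype.card G / 2) * 2 ^ (Fintype.card G / 2 / 2)) := by
  rw [symmetricSquares_eq_biUnion hc h4, card_biUnion (pairwiseDisjoint_fixedSquares hc h4), mul_sum,
    sum_congr rfl (g := fun _ => (Fintype.card G / 2) * 2 ^ (Fintype.card G / 2 / 2)), sum_const, smul_eq_mul]
  intro g hg
  rw [mem_otherInvolutions] at hg
  exact card_fixedSquares hc h4 hg.1 hg.2.1 hg.2.2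

/-! ### Small orbits -/

/-- The orbits of type squares of size `|G|/2`. -/
def smallOrbits (c : G) : Finset (Finset (Finset (Finset G))) :=
  (squareOrbits c).filter fun O => 2 * O.card = Fintype.card G

/-- An orbit has size `|G|/2` iff its squares have stabiliser of order `2` (orbit–stabiliser). -/
theorem two_mul_card_orbitSet_iff {S : Finset (Finset G)} :
    2 * (orbitSet S).card = Fintype.card G ↔ (stabilizerSet S).card = 2 := by
  have h := card_orbitSet_mul_card_stabilizerSet S
  have hpos : 0 < (orbitSet S).card := card_pos.2 ⟨S, self_mem_orbitSet S⟩
  constructor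
  · intro h2
    have h' : (orbitSet S).card * (stabilizerSet S).card = (orbitSet S).card * 2 := by
      rw [h, ← h2, mul_comm]
    exact Nat.eq_of_mul_eq_mul_left hpos h'
  · intro h2
    rw [h2] at h
    rw [mul_comm]; exact h

/-- **`#smallOrbits · m = #symmetricSquares`**: every symmetric square lies in a small orbit, and a small orbit consists
of `m` symmetric squares. -/
theorem card_smallOrbits_mul {c : G} (hc : IsComplexConj c) :
    (smallOrbits c).card * (Fintype.card G / 2) = (symmetricSquares c).card := by
  have hn := card_eq_two_mul_half hc
  -- count the symmetric squares orbit by orbit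
  have hmaps : ∀ S ∈ symmetricSquares c, orbitSet S ∈ smallOrbits c := by
    intro S hS
    rw [symmetricSquares, mem_filter] at hS
    rw [smallOrbits, mem_filter]
    exact ⟨mem_image_of_mem _ hS.1, two_mul_card_orbitSet_iff.2 hS.2⟩
  rw [card_eq_sum_card_fiberwise hmaps]
  rw [sum_congr rfl (g := fun _ => Fintype.card G / 2), sum_const, smul_eq_mul]
  intro O hO
  rw [smallOrbits, mem_filter, squareOrbits, mem_image] at hO
  obtain ⟨⟨S₀, hS₀, rfl⟩, hO2⟩ := hO
  have h2 : (stabilizerSet S₀).card = 2 := two_mul_card_orbitSet_iff.1 hO2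
  have hfib : ((symmetricSquares c).filter fun S => orbitSet S = orbitSet S₀) = orbitSet S₀ := by
    ext S
    rw [mem_filter, symmetricSquares, mem_filter]
    constructor
    · rintro ⟨-, h⟩; rw [← h]; exact self_mem_orbitSet S
    · intro h
      refine ⟨⟨orbitSet_subset_squares hS₀ h, ?_⟩, orbitSet_eq_of_mem h⟩
      rw [card_stabilizerSet_eq_of_mem_orbitSet h, h2]
  rw [hfib]
  omega

/-- **`4·#smallOrbits = ι·2^(m/2)`**: the orbits of size `|G|/2` number `ι·2^(m/2−2)`, `ι` the number of involutions other
than `c` (`|G| = 2m > 4`). -/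
theorem four_mul_card_smallOrbits {c : G} (hc : IsComplexConj c) (h4 : 4 < Fintype.card G) :
    4 * (smallOrbits c).card = (otherInvolutions c).card * 2 ^ (Fintype.card G / 2 / 2) := by
  have h1 := card_symmetricSquares hc h4
  have h2 := card_smallOrbits_mul hc
  have hn := card_eq_two_mul_half hc
  have hm : 0 < Fintype.card G / 2 := by omega
  apply Nat.eq_of_mul_eq_mul_left hm
  calc Fintype.card G / 2 * (4 * (smallOrbits c).card)
      = 4 * ((smallOrbits c).card * (Fintype.card G / 2)) := by ring
    _ = 4 * (symmetricSquares c).card := by rw [h2]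
    _ = (otherInvolutions c).card * ((Fintype.card G / 2) * 2 ^ (Fintype.card G / 2 / 2)) := h1
    _ = Fintype.card G / 2 * ((otherInvolutions c).card * 2 ^ (Fintype.card G / 2 / 2)) := by ring

/-- Every orbit not of size `|G|/2` has size `|G|`. -/
theorem card_eq_of_not_mem_smallOrbits {c : G} (hc : IsComplexConj c) (h4 : 4 < Fintype.card G)
    {O : Finset (Finset (Finset G))} (hO : O ∈ squareOrbits c) (hO' : O ∉ smallOrbits c) :
    O.card = Fintype.card G := by
  rw [smallOrbits, mem_filter, not_and] at hO'
  have hO2 := hO' hO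
  rw [squareOrbits, mem_image] at hO
  obtain ⟨S₀, hS₀, rfl⟩ := hO
  have h := card_orbitSet_mul_card_stabilizerSet S₀
  rcases card_stabilizerSet_eq_one_or_two hc h4 hS₀ with h1 | h1
  · rw [h1, mul_one] at h; exact h
  · exact absurd (two_mul_card_orbitSet_iff.2 h1) hO2

end HodgeRepro.TwistOrbit
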